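import Mathlib
import HarnessLib
import Summits.AtomisticToContinuum.FouriersLaw.Theses.MatthiessenLadder
import Summits.AtomisticToContinuum.FouriersLaw.Theorems.MatthiessenLadderLimitGlue
import Summits.AtomisticToContinuum.FouriersLaw.Theorems.MatthiessenLadderPrefixIncrementBoundsStubPositiveConductanceTop
import Summits.AtomisticToContinuum.FouriersLaw.Theorems.MatthiessenLadderPrefixIncrementBoundsStubPositiveConductanceZero
import Summits.AtomisticToContinuum.FouriersLaw.Theorems.MatthiessenLadderPrefixIncrementBoundsStubCellChainTapEnergyPos

/-!
# Skeleton — crux `PrefixIncrementBounds` (stmt-AtomisticToContinuum-12776)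
# route `MatthiessenLadder` (AtomisticToContinuum / FouriersLaw), line `registered` (birth, reshaped)

The crux (decl `Summit.AtomisticToContinuum.FouriersLaw.Theses.MatthiessenLadder.PrefixIncrementBounds`):
for `ω₂, lam, β, γ > 0` and `T > 0` there are `0 < r_min ≤ r_max` and `k₀, N₀` such that for all
`N ≥ N₀`, `k < N` and all response coefficients `D₀` of the prefix cell chain `cellChain (· < k)` and
`D₁` of `cellChain (· < k+1)` at `(N, T)`: `D₀, D₁ > 0`, `|(N-1)/D₁ - (N-1)/D₀| ≤ r_max`, and
`(N-1)/D₁ - (N-1)/D₀ ≥ r_min` whenever `k₀ ≤ k` and `k + k₀ < N`.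

This is the registered skeleton of the line (the planner's BIRTH skeleton `Lines/birth.lean`, whose
positivity stub lead c2 split into the TOP rung `k ≥ N` and the PREFIX rungs `k < N`; lead c3 closed
the top rung and the HARMONIC base `k = 0` (both landed) and split the remaining MIXED-rung
positivity `0 < k < N` into its two honest halves: the Green–Kubo × tap-energy IDENTITY of the rung
(crux-sized fixed-`N` linear-response theory of the mixed-degree chain, shared with the route's crux
`PrefixSteadyStates`) and the NON-DEGENERACY of the Kubo corrector (first-integral rigidity of the
closed cell chain — ported from the homogeneous proof and landed)). Registered stubs:
`stub_mixedGreenKuboTap`, `stub_upperIncrement`, `stub_bulkLowerIncrement`; closed: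
`positiveConductance_top`, `positiveConductance_zero`, `cellChainTapEnergyPos`; the
kernel-checked composition is `PrefixIncrementBounds_of : PrefixIncrementBounds` (via
`positiveConductance_mixed_of`, `positiveConductance_prefix_of`, `of_parts`, hypotheses form).

* `positiveConductance_top` (CLOSED, p146403) — the top rung `N ≤ k` (`N ≥ 2`): every response
  coefficient of `cellChain (· < k)` at size `N ≤ k` is `> 0` (the chain IS `pinnedChain ω₂ lam β γ`;
  `NessUnique_holds` + `FeketeSeriesLaw.PositiveConductance` + `finiteResponse_of_unique` +
  `pinnedChain_exists_isSteadyState`).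
* `positiveConductance_zero` (CLOSED, p148930) — the harmonic base: every response coefficient of
  the pinned HARMONIC chain `pinnedChain ω₂ 0 0 γ` at `N ≥ 2`, `T > 0` is `> 0` (it equals
  `(N-1)·fluxCoeff ω₂ γ N` by `responseCoeff_harmonic_eq`, weak steady states being identified
  with `harmonicNESS` by `harmonicChain_nessUnique`).
* `stub_mixedGreenKuboTap` — mixed rungs `0 < k < N`, `N ≥ 2`: every response coefficient `D`
  comes with a `C²` Kubo corrector `u` (`L_{T,T}u = -J_tot`) and `Z > 0` such that
  `(N-1)T²·D·Z = γT·(tap energy of u)` (open-chain Green–Kubo + tap-energy identity; crux-sized: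
  `SiteChain` port of ≈ 12–15 kLoC of `pinnedChain` fixed-`N` theory incl. a mixed-degree H2
  Lyapunov function, cf. crux `PrefixSteadyStates` stmt-AtomisticToContinuum-12778).
* `cellChainTapEnergyPos` (CLOSED, p152754) — for any cell profile and `β ≥ 0`, `N ≥ 2`: a `C²`
  solution of the corrector equation has strictly positive tap energy (first-integral rigidity).
* `stub_upperIncrement` — NO QUARTIC CELL IS A MIRROR: `|(N-1)/D₁ - (N-1)/D₀| ≤ r_max` uniformly in
  `(N, k)`, given positive conductances.
* `stub_bulkLowerIncrement` — MATTHIESSEN'S RESISTANCE QUANTUM: `r_min ≤ (N-1)/D₁ - (N-1)/D₀` deep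
  in the bulk, uniformly in `(N, k)`, given positive conductances (the hardest stub; open-problem).

Disproof used: none exists (`ledger crux ls stmt-AtomisticToContinuum-12776`, 2026-08-17: no
`Disproof.lean`, no `Negative/`). The refuter's crux-attack (evidence crux-attack-12776.md /
Scratch.lean): the size guard is load-bearing (`N = 1` has the response coefficient `0`) — every stub
keeps `2 ≤ N` resp. `N₀ ≤ N`; the `k = 0` slot is inhabited (harmonic response) — and
`positiveConductance_zero` shows its response coefficients are all `(N-1)·fluxCoeff ω₂ γ N > 0`.
-/

namespace Summit.AtomisticToContinuum.FouriersLaw.Cruxes.PrefixIncrementBounds.Birth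

open Literature.MathematicalPhysics.KineticTheory.HeatConduction
open Summit.AtomisticToContinuum.FouriersLaw.Theses.MatthiessenLadder

/-! ## Closed pieces (landed) -/

/-- **Top rung — POSITIVE CONDUCTANCE (closed).** For `ω₂, lam, β, γ > 0`, `T > 0`, `2 ≤ N ≤ k`:
every response coefficient `D` of `cellChain (· < k)` at `(N, T)` is `> 0`. Landed as
`Theorems.MatthiessenLadder.PrefixIncrementBoundsTop.stub_positiveConductance_top` (p146403). -/
theorem positiveConductance_top :
    ∀ ω₂ lam β γ : ℝ, 0 < ω₂ → 0 < lam → 0 < β → 0 < γ → ∀ T : ℝ, 0 < T →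
    ∀ N k : ℕ, 2 ≤ N → N ≤ k → ∀ D : ℝ,
      (cellChain ω₂ lam β γ (fun i => decide (i < k))).IsResponseCoeff N T D → 0 < D :=
  Summit.AtomisticToContinuum.FouriersLaw.Theorems.MatthiessenLadder.PrefixIncrementBoundsTop.stub_positiveConductance_top

/-- **Harmonic base — POSITIVE CONDUCTANCE (closed).** For `ω₂, γ > 0`, `T > 0` and `N ≥ 2`,
every response coefficient `D` of the pinned HARMONIC chain `pinnedChain ω₂ 0 0 γ` (as a site chain)
at `(N, T)` is `> 0`: weak-NESS uniqueness of the harmonic chain (`harmonicChain_nessUnique`, landed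
by the `PrefixSteadyStates` lead) identifies every steady-state family with `harmonicNESS`, so
`D = (N-1)·fluxCoeff ω₂ γ N > 0` (`responseCoeff_harmonic_eq`, `fluxCoeff_pos`). Landed as
`Theorems.MatthiessenLadder.PrefixIncrementBoundsZero.stub_positiveConductance_zero` (p148930). -/
theorem positiveConductance_zero :
    ∀ ω₂ γ : ℝ, 0 < ω₂ → 0 < γ → ∀ T : ℝ, 0 < T → ∀ N : ℕ, 2 ≤ N → ∀ D : ℝ,
      (pinnedChain ω₂ 0 0 γ).toSiteChain.IsResponseCoeff N T D → 0 < D :=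
  Summit.AtomisticToContinuum.FouriersLaw.Theorems.MatthiessenLadder.PrefixIncrementBoundsZero.stub_positiveConductance_zero

/-- **Tap-energy positivity — NON-DEGENERACY OF THE KUBO CORRECTOR OF A CELL CHAIN (closed,
p152754; the strictness half of positive conductance).** For ANY cell profile `c`, `β ≥ 0`
(so every bond potential has `V_i'' = 1 + 3[c i]βr² > 0`), `N ≥ 2`, any bath temperatures and any
`T`: a `C²` solution `u` of the corrector equation `L_{T_L,T_R} u = -J_tot` whose contact taps are
square-integrable against the Gibbs weight `e^{-H/T}dx` has STRICTLY positive tap energy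
`∫ (∂_{p_0}u)² e^{-H/T}dx + ∫ (∂_{p_{N-1}}u)² e^{-H/T}dx > 0`. Why true: if both taps vanished
identically, `w = u + Σ_k k·e_k` (`e_k` the site energies, `{H, Σ k e_k} = J_tot`) would be a `C²`
first integral of the CLOSED chain blind to `p_0`; sweeping the chain from the left contact with the
Jacobi identity (`∂_{p_k} w ≡ 0 ⇒ ∂_{q_k} w ≡ 0`, then `V_k''·∂_{p_{k+1}} w ≡ 0`) kills every
derivative of `w`, contradicting `∂_{p_{N-1}} w = (N-1)·p_{N-1}`; continuity turns a.e.-vanishing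
into vanishing. This is `tapEnergy_pos_gibbs` / `corrector_nondegeneracy` / `poisson_hamiltonian_rigidity`
of Theorems/OddSectorIrreversibilityBoundedResponseConvergesStubPositiveConductanceAux1/2.lean
(≈ 660 lines, homogeneous `pinnedChain`) redone for the site-dependent potentials of `cellChain`
(`SiteChain.hamiltonian/generator/bondCurrent`). Landed as
`Theorems.MatthiessenLadder.PrefixIncrementBoundsTap.stub_cellChainTapEnergyPos` (398 lines). -/
theorem cellChainTapEnergyPos :
    ∀ (ω₂ lam β γ T_L T_R T : ℝ), 0 ≤ β → ∀ (c : ℕ → Bool) (N : ℕ), 2 ≤ N →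
      ∀ u : PhaseSpace N → ℝ, ContDiff ℝ 2 u →
      (∀ x, (cellChain ω₂ lam β γ c).generator N T_L T_R u x =
        -∑ i : Fin N, (cellChain ω₂ lam β γ c).bondCurrent N i x) →
      ∀ b₀ b₁ : Fin N, b₀.val = 0 → b₁.val = N - 1 →
      MeasureTheory.Integrable (fun x => (partialP b₀ u x) ^ 2)
        ((MeasureTheory.volume : MeasureTheory.Measure (PhaseSpace N)).withDensity fun x =>
          ENNReal.ofReal (Real.exp (-((cellChain ω₂ lam β γ c).hamiltonian N x) / T))) →
      MeasureTheory.Integrable (fun x => (partialP b₁ u x) ^ 2)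
        ((MeasureTheory.volume : MeasureTheory.Measure (PhaseSpace N)).withDensity fun x =>
          ENNReal.ofReal (Real.exp (-((cellChain ω₂ lam β γ c).hamiltonian N x) / T))) →
      0 < (∫ x, (partialP b₀ u x) ^ 2
          ∂((MeasureTheory.volume : MeasureTheory.Measure (PhaseSpace N)).withDensity fun x =>
            ENNReal.ofReal (Real.exp (-((cellChain ω₂ lam β γ c).hamiltonian N x) / T)))) +
        ∫ x, (partialP b₁ u x) ^ 2
          ∂((MeasureTheory.volume : MeasureTheory.Measure (PhaseSpace N)).withDensity fun x =>
            ENNReal.ofReal (Real.exp (-((cellChain ω₂ lam β γ c).hamiltonian N x) / T))) :=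
  Summit.AtomisticToContinuum.FouriersLaw.Theorems.MatthiessenLadder.PrefixIncrementBoundsTap.stub_cellChainTapEnergyPos

/-! ## The stubs (the only unproved declarations of this file) -/

/-- **Stub 1c · mixedGreenKuboTap — GREEN–KUBO × TAP-ENERGY IDENTITY FOR THE MIXED RUNGS**
(crux-sized; the fixed-`N` linear-response theory of the mixed-degree prefix chains). For
`ω₂, lam, β, γ > 0`, `T > 0`, `2 ≤ N`, `0 < k < N` and every response coefficient `D` of the rung
`P_k = cellChain ω₂ lam β γ (· < k)` at `(N, T)`: there is a `C²` Kubo corrector `u` solving the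
corrector equation `L_{T,T} u = -J_tot` pointwise (`J_tot = Σ_i j_i`), with square-integrable
contact taps `∂_{p_0} u`, `∂_{p_{N-1}} u` against the Gibbs weight `e^{-H/T} dx`, and a constant
`Z > 0` (the partition function) with
`(N-1)·T²·D·Z = γ·T·(∫ (∂_{p_0}u)² e^{-H/T}dx + ∫ (∂_{p_{N-1}}u)² e^{-H/T}dx)` — the open-chain
Green–Kubo formula `(N-1)T²D = ∫₀^∞⟨J_tot, P_t J_tot⟩dt = ⟨J_tot, u⟩` (Kundu–Dhar–Narayan 2009)
combined with the tap-energy identity `⟨u, J_tot⟩ = γT(‖∂_{p_0}u‖² + ‖∂_{p_{N-1}}u‖²)` (integration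
by parts against the Gibbs weight), exactly as `exists_corrector_response_eq_tapEnergy` for the
homogeneous chain (Theorems/OddSectorIrreversibilityBoundedResponseConvergesStubPositiveConductance).
Why plausibly true: standard hypoelliptic fixed-`N` theory (CEHRB 2018 §2–3, Hairer–Majda 2009
Thm 2.3, Rey-Bellet 2003 Rem 4.4); uniqueness of the rung's weak steady state pins `D` to the
Green–Kubo value. Size: L / crux-sized — needs the `SiteChain` port of the Langevin semigroup,
uniform H2 Lyapunov function for mixed degrees 2|4 (new mathematics, CEHRB Rem 2.11), uniform
mixing, Green–Kubo and corrector theory (≈ 12–15 kLoC keyed to `pinnedChain` in tree); its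
existence/uniqueness layer is the route's crux `PrefixSteadyStates` (stmt-AtomisticToContinuum-12778,
lead active: `cellChain_invariantUnique`, `cellChain_smoothDensity` landed 2026-08-17). -/
theorem stub_mixedGreenKuboTap :
    ∀ ω₂ lam β γ : ℝ, 0 < ω₂ → 0 < lam → 0 < β → 0 < γ → ∀ T : ℝ, 0 < T →
    ∀ N k : ℕ, 2 ≤ N → 0 < k → k < N → ∀ D : ℝ,
      (cellChain ω₂ lam β γ (fun i => decide (i < k))).IsResponseCoeff N T D →
      ∀ b₀ b₁ : Fin N, b₀.val = 0 → b₁.val = N - 1 →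
      ∃ u : PhaseSpace N → ℝ, ContDiff ℝ 2 u ∧
        (∀ x, (cellChain ω₂ lam β γ (fun i => decide (i < k))).generator N T T u x =
          -∑ i : Fin N, (cellChain ω₂ lam β γ (fun i => decide (i < k))).bondCurrent N i x) ∧
        MeasureTheory.Integrable (fun x => (partialP b₀ u x) ^ 2)
          ((MeasureTheory.volume : MeasureTheory.Measure (PhaseSpace N)).withDensity fun x =>
            ENNReal.ofReal (Real.exp
              (-((cellChain ω₂ lam β γ (fun i => decide (i < k))).hamiltonian N x) / T))) ∧
        MeasureTheory.Integrable (fun x => (partialP b₁ u x) ^ 2)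
          ((MeasureTheory.volume : MeasureTheory.Measure (PhaseSpace N)).withDensity fun x =>
            ENNReal.ofReal (Real.exp
              (-((cellChain ω₂ lam β γ (fun i => decide (i < k))).hamiltonian N x) / T))) ∧
        ∃ Z : ℝ, 0 < Z ∧ ((N : ℝ) - 1) * T ^ 2 * D * Z =
          γ * T * ((∫ x, (partialP b₀ u x) ^ 2
              ∂((MeasureTheory.volume : MeasureTheory.Measure (PhaseSpace N)).withDensity fun x =>
                ENNReal.ofReal (Real.exp
                  (-((cellChain ω₂ lam β γ (fun i => decide (i < k))).hamiltonian N x) / T)))) +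
            ∫ x, (partialP b₁ u x) ^ 2
              ∂((MeasureTheory.volume : MeasureTheory.Measure (PhaseSpace N)).withDensity fun x =>
                ENNReal.ofReal (Real.exp
                  (-((cellChain ω₂ lam β γ (fun i => decide (i < k))).hamiltonian N x) / T)))) := by
  sorry

/-- **Stub 2 · upperIncrement — NO QUARTIC CELL IS A MIRROR (Lipschitz in the support).** For
`ω₂, lam, β, γ > 0` and `T > 0` there are `r_max` and `N₀` such that for all `N ≥ N₀`, `k < N` and
all POSITIVE response coefficients `D₀` of `cellChain (· < k)` and `D₁` of `cellChain (· < k+1)` at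
`(N, T)`, `|(N-1)/D₁ - (N-1)/D₀| ≤ r_max` (uniform in `N` and in the interface position, contacts
included). Why plausibly true: one uniformly convex quartic cell (`U'' ≥ ω₂`, `V'' ≥ 1`) cannot
reflect a fixed fraction of the flux uniformly in the length (first-order NESS perturbation theory in
the support, Lefevere–Schenkel 2006; non-reversible Dirichlet/Thomson principles,
Landim–Mariani–Seo 2018). Why it might fail: no Lipschitz-in-support bound on the RESISTANCE near the
contacts is in print (Kapitza-type jumps). Size: L / open (wave-1 analysis: splits exactly into a
long-lead part `k + m₀ < N` and a contact-layer part `k = N-1-m`, both open; evidence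
work/stubs/stub_upperIncrement.lean). -/
theorem stub_upperIncrement :
    ∀ ω₂ lam β γ : ℝ, 0 < ω₂ → 0 < lam → 0 < β → 0 < γ → ∀ T : ℝ, 0 < T →
    ∃ rmax : ℝ, ∃ N₀ : ℕ, ∀ N k : ℕ, N₀ ≤ N → k < N → ∀ D₀ D₁ : ℝ,
      (cellChain ω₂ lam β γ (fun i => decide (i < k))).IsResponseCoeff N T D₀ →
      (cellChain ω₂ lam β γ (fun i => decide (i < k + 1))).IsResponseCoeff N T D₁ →
      0 < D₀ → 0 < D₁ → |((N : ℝ) - 1) / D₁ - ((N : ℝ) - 1) / D₀| ≤ rmax := by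
  sorry

/-- **Stub 3 · bulkLowerIncrement — MATTHIESSEN'S RESISTANCE QUANTUM** (HARDEST; the crux's
load-bearing claim). For `ω₂, lam, β, γ > 0` and `T > 0` there are `r_min > 0` and `k₀, N₀` such
that for all `N ≥ N₀`, all BULK interface positions (`k₀ ≤ k`, `k + k₀ < N`) and all positive
response coefficients `D₀` of `cellChain (· < k)` and `D₁` of `cellChain (· < k+1)` at `(N, T)`,
`r_min ≤ (N-1)/D₁ - (N-1)/D₀`. Why plausibly true: a quartic cell switched on behind `k ≥ k₀`
anharmonic cells and in front of a ballistic harmonic lead adds an inelastic scatterer in series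
(Matthiessen/Kohler additivity). Why it might fail (route header): locality may fail coherently —
nothing proves the interface increment is `Θ(1)` uniformly in `(N, k)` at fixed `T`. Size:
open-problem (with `IncrementGlue` it yields `BoundedResponse`, i.e. `κ_N(T) = O(1)` for the
anharmonic pinned chain — the open half of Fourier's law, Bonetto–Lebowitz–Rey-Bellet 2000 §6.3). -/
theorem stub_bulkLowerIncrement :
    ∀ ω₂ lam β γ : ℝ, 0 < ω₂ → 0 < lam → 0 < β → 0 < γ → ∀ T : ℝ, 0 < T →
    ∃ rmin : ℝ, 0 < rmin ∧ ∃ k₀ N₀ : ℕ, ∀ N k : ℕ, N₀ ≤ N → k₀ ≤ k → k + k₀ < N → ∀ D₀ D₁ : ℝ,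
      (cellChain ω₂ lam β γ (fun i => decide (i < k))).IsResponseCoeff N T D₀ →
      (cellChain ω₂ lam β γ (fun i => decide (i < k + 1))).IsResponseCoeff N T D₁ →
      0 < D₀ → 0 < D₁ → rmin ≤ ((N : ℝ) - 1) / D₁ - ((N : ℝ) - 1) / D₀ := by
  sorry

/-! ## The composition (fully proved) -/

/-- **Mixed-rung positivity from the Green–Kubo × tap identity and tap-energy positivity**
(`N₀ := 2`): `(N-1)·T²·D·Z = γ·T·(tap energy) > 0` with `N - 1, T, Z > 0` forces `D > 0`.
[folklore] -/
theorem positiveConductance_mixed_of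
    (hgk : ∀ ω₂ lam β γ : ℝ, 0 < ω₂ → 0 < lam → 0 < β → 0 < γ → ∀ T : ℝ, 0 < T →
      ∀ N k : ℕ, 2 ≤ N → 0 < k → k < N → ∀ D : ℝ,
      (cellChain ω₂ lam β γ (fun i => decide (i < k))).IsResponseCoeff N T D →
      ∀ b₀ b₁ : Fin N, b₀.val = 0 → b₁.val = N - 1 →
      ∃ u : PhaseSpace N → ℝ, ContDiff ℝ 2 u ∧
        (∀ x, (cellChain ω₂ lam β γ (fun i => decide (i < k))).generator N T T u x =
          -∑ i : Fin N, (cellChain ω₂ lam β γ (fun i => decide (i < k))).bondCurrent N i x) ∧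
        MeasureTheory.Integrable (fun x => (partialP b₀ u x) ^ 2)
          ((MeasureTheory.volume : MeasureTheory.Measure (PhaseSpace N)).withDensity fun x =>
            ENNReal.ofReal (Real.exp
              (-((cellChain ω₂ lam β γ (fun i => decide (i < k))).hamiltonian N x) / T))) ∧
        MeasureTheory.Integrable (fun x => (partialP b₁ u x) ^ 2)
          ((MeasureTheory.volume : MeasureTheory.Measure (PhaseSpace N)).withDensity fun x =>
            ENNReal.ofReal (Real.exp
              (-((cellChain ω₂ lam β γ (fun i => decide (i < k))).hamiltonian N x) / T))) ∧
        ∃ Z : ℝ, 0 < Z ∧ ((N : ℝ) - 1) * T ^ 2 * D * Z =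
          γ * T * ((∫ x, (partialP b₀ u x) ^ 2
              ∂((MeasureTheory.volume : MeasureTheory.Measure (PhaseSpace N)).withDensity fun x =>
                ENNReal.ofReal (Real.exp
                  (-((cellChain ω₂ lam β γ (fun i => decide (i < k))).hamiltonian N x) / T)))) +
            ∫ x, (partialP b₁ u x) ^ 2
              ∂((MeasureTheory.volume : MeasureTheory.Measure (PhaseSpace N)).withDensity fun x =>
                ENNReal.ofReal (Real.exp
                  (-((cellChain ω₂ lam β γ (fun i => decide (i < k))).hamiltonian N x) / T)))))
    (htap : ∀ (ω₂ lam β γ T_L T_R T : ℝ), 0 ≤ β → ∀ (c : ℕ → Bool) (N : ℕ), 2 ≤ N →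
      ∀ u : PhaseSpace N → ℝ, ContDiff ℝ 2 u →
      (∀ x, (cellChain ω₂ lam β γ c).generator N T_L T_R u x =
        -∑ i : Fin N, (cellChain ω₂ lam β γ c).bondCurrent N i x) →
      ∀ b₀ b₁ : Fin N, b₀.val = 0 → b₁.val = N - 1 →
      MeasureTheory.Integrable (fun x => (partialP b₀ u x) ^ 2)
        ((MeasureTheory.volume : MeasureTheory.Measure (PhaseSpace N)).withDensity fun x =>
          ENNReal.ofReal (Real.exp (-((cellChain ω₂ lam β γ c).hamiltonian N x) / T))) →
      MeasureTheory.Integrable (fun x => (partialP b₁ u x) ^ 2)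
        ((MeasureTheory.volume : MeasureTheory.Measure (PhaseSpace N)).withDensity fun x =>
          ENNReal.ofReal (Real.exp (-((cellChain ω₂ lam β γ c).hamiltonian N x) / T))) →
      0 < (∫ x, (partialP b₀ u x) ^ 2
          ∂((MeasureTheory.volume : MeasureTheory.Measure (PhaseSpace N)).withDensity fun x =>
            ENNReal.ofReal (Real.exp (-((cellChain ω₂ lam β γ c).hamiltonian N x) / T)))) +
        ∫ x, (partialP b₁ u x) ^ 2
          ∂((MeasureTheory.volume : MeasureTheory.Measure (PhaseSpace N)).withDensity fun x =>
            ENNReal.ofReal (Real.exp (-((cellChain ω₂ lam β γ c).hamiltonian N x) / T)))) :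
    ∀ ω₂ lam β γ : ℝ, 0 < ω₂ → 0 < lam → 0 < β → 0 < γ → ∀ T : ℝ, 0 < T →
      ∃ N₀ : ℕ, ∀ N k : ℕ, N₀ ≤ N → 0 < k → k < N → ∀ D : ℝ,
        (cellChain ω₂ lam β γ (fun i => decide (i < k))).IsResponseCoeff N T D → 0 < D := by
  intro ω₂ lam β γ hω hl hβ hγ T hT
  refine ⟨2, fun N k hN hk0 hk D hD => ?_⟩
  obtain ⟨u, hu, hLu, hi₀, hi₁, Z, hZ, hid⟩ :=
    hgk ω₂ lam β γ hω hl hβ hγ T hT N k hN hk0 hk D hD ⟨0, by omega⟩ ⟨N - 1, by omega⟩ rfl rfl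
  have htap' := htap ω₂ lam β γ T T T hβ.le (fun i => decide (i < k)) N hN u hu hLu
    ⟨0, by omega⟩ ⟨N - 1, by omega⟩ rfl rfl hi₀ hi₁
  have hN1 : (0 : ℝ) < (N : ℝ) - 1 := by
    have : (2 : ℝ) ≤ N := by exact_mod_cast hN
    linarith
  have hrhs : 0 < ((N : ℝ) - 1) * T ^ 2 * D * Z := by
    rw [hid]; exact mul_pos (mul_pos hγ hT) htap'
  have hc : 0 < ((N : ℝ) - 1) * T ^ 2 * Z := by positivity
  refine lt_of_not_ge fun hneg => ?_
  have : ((N : ℝ) - 1) * T ^ 2 * D * Z ≤ 0 := by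
    have e : ((N : ℝ) - 1) * T ^ 2 * D * Z = (((N : ℝ) - 1) * T ^ 2 * Z) * D := by ring
    rw [e]
    exact mul_nonpos_of_nonneg_of_nonpos hc.le hneg
  linarith

/-- **Prefix positivity from the harmonic base and the mixed rungs.** For `N ≥ max N₀ 2` and
`k < N`: `k = 0` is the pinned harmonic chain (`cellChain_lt_zero_isResponseCoeff`), `0 < k` a mixed
rung. [folklore] -/
theorem positiveConductance_prefix_of
    (hzero : ∀ ω₂ γ : ℝ, 0 < ω₂ → 0 < γ → ∀ T : ℝ, 0 < T → ∀ N : ℕ, 2 ≤ N → ∀ D : ℝ,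
      (pinnedChain ω₂ 0 0 γ).toSiteChain.IsResponseCoeff N T D → 0 < D)
    (hmixed : ∀ ω₂ lam β γ : ℝ, 0 < ω₂ → 0 < lam → 0 < β → 0 < γ → ∀ T : ℝ, 0 < T →
      ∃ N₀ : ℕ, ∀ N k : ℕ, N₀ ≤ N → 0 < k → k < N → ∀ D : ℝ,
        (cellChain ω₂ lam β γ (fun i => decide (i < k))).IsResponseCoeff N T D → 0 < D) :
    ∀ ω₂ lam β γ : ℝ, 0 < ω₂ → 0 < lam → 0 < β → 0 < γ → ∀ T : ℝ, 0 < T →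
      ∃ N₀ : ℕ, ∀ N k : ℕ, N₀ ≤ N → k < N → ∀ D : ℝ,
        (cellChain ω₂ lam β γ (fun i => decide (i < k))).IsResponseCoeff N T D → 0 < D := by
  intro ω₂ lam β γ hω hl hβ hγ T hT
  obtain ⟨N₀, h⟩ := hmixed ω₂ lam β γ hω hl hβ hγ T hT
  refine ⟨max N₀ 2, fun N k hN hk D hD => ?_⟩
  rcases Nat.eq_zero_or_pos k with rfl | hk0
  · rw [Summit.AtomisticToContinuum.FouriersLaw.Theorems.MatthiessenLadder.cellChain_lt_zero_isResponseCoeff]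
      at hD
    exact hzero ω₂ γ hω hγ T hT N (le_trans (le_max_right _ _) hN) D hD
  · exact h N k (le_trans (le_max_left _ _) hN) hk0 hk D hD

/-- **Composition, hypotheses form** (`<top-sig> → <stub1b-sig> → <stub1c-sig> → <stub2-sig> →
<stub3-sig> →` the body of `PrefixIncrementBounds`; the hypotheses are VERBATIM the types of
`positiveConductance_top`, `positiveConductance_zero`, `stub_positiveConductance_mixed`,
`stub_upperIncrement`, `stub_bulkLowerIncrement`): take `r_min` from the bulk lower bound,
`r_max := max r_max r_min`, `k₀` from the bulk lower bound and `N₀ :=` the max of the three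
thresholds and `2`; positivity of `D₀` (rung `k < N`) comes from the prefix positivity
(`positiveConductance_prefix_of`), positivity of `D₁` from it when `k + 1 < N` and from the top
hypothesis when `k + 1 = N`; both feed the increment bounds. -/
theorem of_parts
    (htop : ∀ ω₂ lam β γ : ℝ, 0 < ω₂ → 0 < lam → 0 < β → 0 < γ → ∀ T : ℝ, 0 < T →
      ∀ N k : ℕ, 2 ≤ N → N ≤ k → ∀ D : ℝ,
        (cellChain ω₂ lam β γ (fun i => decide (i < k))).IsResponseCoeff N T D → 0 < D)
    (hzero : ∀ ω₂ γ : ℝ, 0 < ω₂ → 0 < γ → ∀ T : ℝ, 0 < T → ∀ N : ℕ, 2 ≤ N → ∀ D : ℝ,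
      (pinnedChain ω₂ 0 0 γ).toSiteChain.IsResponseCoeff N T D → 0 < D)
    (hmixed : ∀ ω₂ lam β γ : ℝ, 0 < ω₂ → 0 < lam → 0 < β → 0 < γ → ∀ T : ℝ, 0 < T →
      ∃ N₀ : ℕ, ∀ N k : ℕ, N₀ ≤ N → 0 < k → k < N → ∀ D : ℝ,
        (cellChain ω₂ lam β γ (fun i => decide (i < k))).IsResponseCoeff N T D → 0 < D)
    (hup : ∀ ω₂ lam β γ : ℝ, 0 < ω₂ → 0 < lam → 0 < β → 0 < γ → ∀ T : ℝ, 0 < T →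
      ∃ rmax : ℝ, ∃ N₀ : ℕ, ∀ N k : ℕ, N₀ ≤ N → k < N → ∀ D₀ D₁ : ℝ,
        (cellChain ω₂ lam β γ (fun i => decide (i < k))).IsResponseCoeff N T D₀ →
        (cellChain ω₂ lam β γ (fun i => decide (i < k + 1))).IsResponseCoeff N T D₁ →
        0 < D₀ → 0 < D₁ → |((N : ℝ) - 1) / D₁ - ((N : ℝ) - 1) / D₀| ≤ rmax)
    (hlow : ∀ ω₂ lam β γ : ℝ, 0 < ω₂ → 0 < lam → 0 < β → 0 < γ → ∀ T : ℝ, 0 < T →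
      ∃ rmin : ℝ, 0 < rmin ∧ ∃ k₀ N₀ : ℕ, ∀ N k : ℕ, N₀ ≤ N → k₀ ≤ k → k + k₀ < N → ∀ D₀ D₁ : ℝ,
        (cellChain ω₂ lam β γ (fun i => decide (i < k))).IsResponseCoeff N T D₀ →
        (cellChain ω₂ lam β γ (fun i => decide (i < k + 1))).IsResponseCoeff N T D₁ →
        0 < D₀ → 0 < D₁ → rmin ≤ ((N : ℝ) - 1) / D₁ - ((N : ℝ) - 1) / D₀) :
    ∀ ω₂ lam β γ : ℝ, 0 < ω₂ → 0 < lam → 0 < β → 0 < γ → ∀ T : ℝ, 0 < T → ∃ rmin rmax : ℝ,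
      0 < rmin ∧ rmin ≤ rmax ∧ ∃ k₀ N₀ : ℕ, ∀ N k : ℕ, N₀ ≤ N → k < N → ∀ D₀ D₁ : ℝ,
        (cellChain ω₂ lam β γ (fun i => decide (i < k))).IsResponseCoeff N T D₀ →
        (cellChain ω₂ lam β γ (fun i => decide (i < k + 1))).IsResponseCoeff N T D₁ →
        0 < D₀ ∧ 0 < D₁ ∧ |((N : ℝ) - 1) / D₁ - ((N : ℝ) - 1) / D₀| ≤ rmax ∧
          (k₀ ≤ k → k + k₀ < N → rmin ≤ ((N : ℝ) - 1) / D₁ - ((N : ℝ) - 1) / D₀) := by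
  intro ω₂ lam β γ hω hl hβ hγ T hT
  have h₀ := htop ω₂ lam β γ hω hl hβ hγ T hT
  obtain ⟨N₁, h₁⟩ := positiveConductance_prefix_of hzero hmixed ω₂ lam β γ hω hl hβ hγ T hT
  obtain ⟨rmax, N₂, h₂⟩ := hup ω₂ lam β γ hω hl hβ hγ T hT
  obtain ⟨rmin, hrmin, k₀, N₃, h₃⟩ := hlow ω₂ lam β γ hω hl hβ hγ T hT
  refine ⟨rmin, max rmax rmin, hrmin, le_max_right _ _, k₀, max (max (max N₁ N₂) N₃) 2, ?_⟩
  intro N k hN hk D₀ D₁ hD₀ hD₁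
  have hN₁ : N₁ ≤ N :=
    le_trans (le_trans (le_trans (le_max_left _ _) (le_max_left _ _)) (le_max_left _ _)) hN
  have hN₂ : N₂ ≤ N :=
    le_trans (le_trans (le_trans (le_max_right _ _) (le_max_left _ _)) (le_max_left _ _)) hN
  have hN₃ : N₃ ≤ N := le_trans (le_trans (le_max_right _ _) (le_max_left _ _)) hN
  have hN2 : 2 ≤ N := le_trans (le_max_right _ _) hN
  have p₀ : 0 < D₀ := h₁ N k hN₁ hk D₀ hD₀
  have p₁ : 0 < D₁ := by
    rcases Nat.lt_or_ge (k + 1) N with hlt | hge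
    · exact h₁ N (k + 1) hN₁ hlt D₁ hD₁
    · exact h₀ N (k + 1) hN2 hge D₁ hD₁
  refine ⟨p₀, p₁, ?_, ?_⟩
  · exact le_trans (h₂ N k hN₂ hk D₀ D₁ hD₀ hD₁ p₀ p₁) (le_max_left _ _)
  · intro hk₀ hkN
    exact h₃ N k hN₃ hk₀ hkN D₀ D₁ hD₀ hD₁ p₀ p₁

/-- **The skeleton theorem.** The stubs imply the crux `MatthiessenLadder.PrefixIncrementBounds`,
concluded BY NAME; the only unproved inputs are `stub_mixedGreenKuboTap`,
`stub_upperIncrement`, `stub_bulkLowerIncrement` (`positiveConductance_top`,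
`positiveConductance_zero` and `cellChainTapEnergyPos` are landed). -/
theorem PrefixIncrementBounds_of : PrefixIncrementBounds :=
  of_parts positiveConductance_top positiveConductance_zero
    (positiveConductance_mixed_of stub_mixedGreenKuboTap cellChainTapEnergyPos)
    stub_upperIncrement stub_bulkLowerIncrement

end Summit.AtomisticToContinuum.FouriersLaw.Cruxes.PrefixIncrementBounds.Birth
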